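import Summits.HodgeConjecture.HodgeConjecture.Theses.QbarEnvelope
import Summits.HodgeConjecture.HodgeConjecture.Theorems.LinearSystemTorelliMiddleDivisorSupportFourfoldCodimTwoIff
import Literature.AlgebraicGeometry.HodgeTheory.AlgebraicClassesPullback

/-!
# Route `LinearSystemTorelli` — crux `MiddleDivisorSupportFourfold` (stmt-HodgeConjecture-2409)
# is downstream of route `QbarEnvelope` (Voisin's arithmetic funnel at `(n, p) = (4, 2)`)

Helper file for the crux item stmt-HodgeConjecture-2409 (`--supports`; it closes nothing), line
`IdeatorFiveSketch` (idea `weakly-nonfactor-descent`, skeleton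
`Cruxes/MiddleDivisorSupportFourfold/Lines/IdeatorFiveSketch.lean`). It records, kernel-checked and
with no new definition, named fact or `sorry`, the cross-route implications

* `linearSystemTorelli_hc42_of_codimTwo_instances` — TRANSFER ∧ SECTOR ∧ GLUE ⟹ HC(4,2): if every
  rational `(2,2)`-class on a smooth projective complex fourfold is a pull-back `ι^* c'` of a rational
  `(2,2)`-class `c'` on a smooth projective `W` definable over a number field (the `(4,2)` instance of
  `QbarEnvelope.Envelope`, stmt-1069: Voisin 2007 Prop. 1.7 / Charles–Schnell Thm 11.3.19, a theorem
  of Klingler–Otwinowska–Urbanik 2023 Thm 1.12(a) off the isolated / factor-type residual), if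
  rational `(2,2)`-classes on such `W` are algebraic in every dimension (the codimension-2 slice of
  `QbarEnvelope.HCOverNumberFields`, stmt-1070), and if pull-back preserves codimension-2 algebraic
  classes (the `p = 2` instance of `QbarEnvelope.PullbackAlgebraic`, stmt-1071 = Fulton Cor. 19.2 (b)),
  then every rational `(2,2)`-class on a smooth projective complex fourfold is algebraic;
* `linearSystemTorelli_middleDivisorSupportFourfold_of_codimTwo_instances` — hence the crux (divisor
  support), by `Alg² = N²H⁴ ≤ N¹H⁴` (`linearSystemTorelli_middleDivisorSupportFourfold_of_hc42`);
* `linearSystemTorelli_middleDivisorSupportFourfold_of_qbarEnvelope` — the same from the three items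
  of route `QbarEnvelope` verbatim: stmt-2409 ⟸ stmt-1069 ∧ stmt-1070 ∧ stmt-1071;
* `linearSystemTorelli_middleDivisorSupportFourfold_of_envelope_of_hcOverNumberFields_of_fulton` — the
  same with the glue item replaced by the Literature named fact
  `HodgeTheory.fulton1998_map_mem_algebraicClasses` (undischarged; file `AlgebraicClassesPullback`):
  stmt-2409 ⟸ stmt-1069 ∧ stmt-1070 modulo Fulton Cor. 19.2 (b).

Consequence recorded for the crux chain: the crux of `LinearSystemTorelli` at the fourfold level is a
CONSEQUENCE of the two cruxes of route `QbarEnvelope` (plus a theorem in print); conversely the crux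
implies the fourfold slice of each (it is HC(4,2), `linearSystemTorelli_middleDivisorSupportFourfold_iff_hc42`),
so a lead holding this line holds exactly the `p = 2` shadow of `QbarEnvelope`.
-/

noncomputable section

namespace Summit.HodgeConjecture.HodgeConjecture.Theorems

open CategoryTheory
open Summit.HodgeConjecture.HodgeConjecture.Theses
open Summit.HodgeConjecture.HodgeConjecture.Theses.LinearSystemTorelli
open Literature.AlgebraicGeometry Literature.AlgebraicGeometry.HodgeTheory
open Literature.AlgebraicGeometry.Motives

/-- **Envelope(4,2) ∧ HCℚ̄(·,2) ∧ Pullback(2) ⟹ HC(4,2).** Take the `ℚ̄`-envelope `(W, ι, c')` of a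
rational `(2,2)`-class `c` on the fourfold `X`, apply the Hodge conjecture over number fields in
codimension 2 to `c'` on `W`, and pull back along `ι`. The three hypotheses are the `(4,2)` / `p = 2`
instances of the items `Envelope`, `HCOverNumberFields`, `PullbackAlgebraic` of route `QbarEnvelope`,
written out. [cite: Voisin2007HodgeLoci, Prop. 1.7] [cite: CharlesSchnell2014Notes, Thm 11.3.19]
[cite: Fulton1998, Cor. 19.2 (b)] -/
theorem linearSystemTorelli_hc42_of_codimTwo_instances
    (hE : ∀ ⦃X : SchemeOver ℂ⦄, IsSmoothProjective 4 X → ∀ (c : complexBetti X 4), IsRationalClass c →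
      IsOfHodgeType 4 X 4 2 2 c →
        ∃ (m : ℕ) (W : SchemeOver ℂ) (ι : X ⟶ W) (c' : complexBetti W 4), IsSmoothProjective m W ∧
          (∃ (K : Type) (_ : Field K) (_ : NumberField K) (σ : K →+* ℂ) (W₀ : SchemeOver K),
            Nonempty (W ≅ (baseChangeHom σ).obj W₀)) ∧
          IsRationalClass c' ∧ IsOfHodgeType m W 4 2 2 c' ∧ complexBetti.map ι 4 c' = c)
    (hQ : ∀ ⦃m : ℕ⦄ ⦃W : SchemeOver ℂ⦄, IsSmoothProjective m W →
      (∃ (K : Type) (_ : Field K) (_ : NumberField K) (σ : K →+* ℂ) (W₀ : SchemeOver K),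
        Nonempty (W ≅ (baseChangeHom σ).obj W₀)) →
      ∀ (c' : complexBetti W 4), IsRationalClass c' → IsOfHodgeType m W 4 2 2 c' →
        c' ∈ algebraicClasses W 2)
    (hP : ∀ ⦃n : ℕ⦄ ⦃X : SchemeOver ℂ⦄, IsSmoothProjective n X → ∀ ⦃m : ℕ⦄ ⦃W : SchemeOver ℂ⦄,
      IsSmoothProjective m W → ∀ (ι : X ⟶ W) (c' : complexBetti W 4),
        c' ∈ algebraicClasses W 2 → complexBetti.map ι 4 c' ∈ algebraicClasses X 2) :
    ∀ ⦃X : SchemeOver ℂ⦄, IsSmoothProjective 4 X →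
      ∀ c : complexBetti X 4, IsRationalClass c → IsOfHodgeType 4 X 4 2 2 c →
        c ∈ algebraicClasses X 2 := by
  intro X hX c hc hh
  obtain ⟨m, W, ι, c', hW, hK, hc', hh', hmap⟩ := hE hX c hc hh
  rw [← hmap]
  exact hP hX hW ι c' (hQ hW hK c' hc' hh')

/-- **Envelope(4,2) ∧ HCℚ̄(·,2) ∧ Pullback(2) ⟹ crux** (`MiddleDivisorSupportFourfold`, divisor support
of rational `(2,2)`-classes on fourfolds): HC(4,2) from the three instances, then
`algebraicClasses X 2 = N²H⁴ ≤ N¹H⁴ = supportedClasses X 4 1`. This is the composition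
`MiddleDivisorSupportFourfold_of` of the line's skeleton with its three stubs as hypotheses.
[cite: Voisin2007HodgeLoci, Prop. 1.7] [cite: GrothendieckTopology1969, §1] -/
theorem linearSystemTorelli_middleDivisorSupportFourfold_of_codimTwo_instances
    (hE : ∀ ⦃X : SchemeOver ℂ⦄, IsSmoothProjective 4 X → ∀ (c : complexBetti X 4), IsRationalClass c →
      IsOfHodgeType 4 X 4 2 2 c →
        ∃ (m : ℕ) (W : SchemeOver ℂ) (ι : X ⟶ W) (c' : complexBetti W 4), IsSmoothProjective m W ∧
          (∃ (K : Type) (_ : Field K) (_ : NumberField K) (σ : K →+* ℂ) (W₀ : SchemeOver K),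
            Nonempty (W ≅ (baseChangeHom σ).obj W₀)) ∧
          IsRationalClass c' ∧ IsOfHodgeType m W 4 2 2 c' ∧ complexBetti.map ι 4 c' = c)
    (hQ : ∀ ⦃m : ℕ⦄ ⦃W : SchemeOver ℂ⦄, IsSmoothProjective m W →
      (∃ (K : Type) (_ : Field K) (_ : NumberField K) (σ : K →+* ℂ) (W₀ : SchemeOver K),
        Nonempty (W ≅ (baseChangeHom σ).obj W₀)) →
      ∀ (c' : complexBetti W 4), IsRationalClass c' → IsOfHodgeType m W 4 2 2 c' →
        c' ∈ algebraicClasses W 2)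
    (hP : ∀ ⦃n : ℕ⦄ ⦃X : SchemeOver ℂ⦄, IsSmoothProjective n X → ∀ ⦃m : ℕ⦄ ⦃W : SchemeOver ℂ⦄,
      IsSmoothProjective m W → ∀ (ι : X ⟶ W) (c' : complexBetti W 4),
        c' ∈ algebraicClasses W 2 → complexBetti.map ι 4 c' ∈ algebraicClasses X 2) :
    MiddleDivisorSupportFourfold :=
  linearSystemTorelli_middleDivisorSupportFourfold_of_hc42
    (linearSystemTorelli_hc42_of_codimTwo_instances hE hQ hP)

/-- **stmt-2409 ⟸ stmt-1069 ∧ stmt-1070 ∧ stmt-1071**: the crux `MiddleDivisorSupportFourfold` of route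
`LinearSystemTorelli` follows from the three items `Envelope`, `HCOverNumberFields`,
`PullbackAlgebraic` of route `QbarEnvelope` (their `(4,2)` / `p = 2` instances suffice).
[cite: Voisin2007HodgeLoci, Prop. 1.7] [cite: CharlesSchnell2014Notes, Thm 11.3.19] -/
theorem linearSystemTorelli_middleDivisorSupportFourfold_of_qbarEnvelope :
    QbarEnvelope.Envelope → QbarEnvelope.HCOverNumberFields → QbarEnvelope.PullbackAlgebraic →
      MiddleDivisorSupportFourfold :=
  fun hE hQ hP => linearSystemTorelli_middleDivisorSupportFourfold_of_codimTwo_instances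
    (fun _ hX c hc hh => hE hX 2 c hc hh) (fun _ _ hW hK c' hc' hh' => (hQ hW hK).2 2 c' hc' hh')
    (fun _ _ hX _ _ hW ι c' hc' => hP hX hW ι 2 c' hc')

/-- **stmt-2409 ⟸ stmt-1069 ∧ stmt-1070 modulo Fulton Cor. 19.2 (b)**: the same with the glue supplied
by the Literature named fact `fulton1998_map_mem_algebraicClasses` (pull-back of algebraic classes
along morphisms of smooth projective varieties; undischarged in the tree, proved there for flat maps,
isomorphisms, abelian targets and the degrees `p = 0`, `p ≥ dim`). [cite: Fulton1998, Cor. 19.2 (b)]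
[cite: Voisin2007HodgeLoci, Prop. 1.7] -/
theorem linearSystemTorelli_middleDivisorSupportFourfold_of_envelope_of_hcOverNumberFields_of_fulton
    (hE : QbarEnvelope.Envelope) (hQ : QbarEnvelope.HCOverNumberFields)
    (hF : fulton1998_map_mem_algebraicClasses) : MiddleDivisorSupportFourfold :=
  linearSystemTorelli_middleDivisorSupportFourfold_of_qbarEnvelope hE hQ hF.pullbackAlgebraic

end Summit.HodgeConjecture.HodgeConjecture.Theorems

end
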